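import Literature.NumberTheory.Automorphic.CDTTheorem722
import Literature.NumberTheory.Automorphic.FLSModularityLiftingTheorem
import Literature.NumberTheory.EllipticCurves.GlobalMinimalModelProofs
import Literature.NumberTheory.EllipticCurves.LFunctionSmulProofs
import Literature.NumberTheory.EllipticCurves.SzpiroOfAbcProofs
import Literature.NumberTheory.EllipticCurves.MatarNekovar2019.IrreducibleOverQuadraticFieldClauseThreeProofs
import Literature.RepresentationTheory.Semisimple.BurnsideMatrixSpan
import Literature.NumberTheory.GaloisRepresentations.AbsolutelyIrreducibleReductionBridge
import Summits.ABC.ABC.Theorems.DefiniteXiFreyModularityStubAbsIrrNegThreeGroup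
import HarnessLib

/-!
# Stub-ideation k1, GEN 4 (2026-08-31) for `stub_liftThree` (crux stmt-ABC-11340 `FreyModularity`, line `Sketch`)

Backs `STUB-IDEAS-stub_liftThree-1.md` (HOME FAMILY 1 — RECOGNISE & IMPORT), gen 4 = "tree match,
two levels deep".  Gens 1–3 (`STUB_IDEAS_stub_liftThree_1{,g2,g3}.lean`) fixed the SEATS (Rubin
Thm B; Diamond CSS-XVII Cor. 6.3; `FLS2015_theorem3` at `(ℚ,3)`) and left FIVE sorried helpers on
the FLS road: D1a (`ℚ(ζ₃)` is a splitting field of `X²+3`), D1b (conjugation invariance of absolute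
irreducibility), B4 (integral model), B6 (model invariance of `BCDT.IsModular`), D4a/B3 (adelic ⇒
classical).  Gen 4 RECOGNISES four of the five in the tree and closes them BY CITATION (≤ 10 lines
each, no new mathematics):

* D1 is closed WITHOUT D1a: the tree's FLS Prop. 3.1 (i) lemma
  `mem_range_absGaloisRestrict_cyclotomic_iff` (`Γ_{ℚ(ζ₃)} = ker χ̄₃`, ANY model) + the crux's own
  landed `Summit.ABC.ABC.Theorems.modPCyclotomicCharacter_three_eq_one_of_mem_range`
  (`Γ_{ℚ(√-3)} ⊆ ker χ̄₃`) give `Γ_{ℚ(√-3)} ⊆ Γ_{ℚ(ζ₃)}` inside `Γ_ℚ` (R0), and absolute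
  irreducibility only depends on the image, monotonically (R1) and up to conjugation (D1b) — both
  ONE-LINERS off the tree's Burnside criterion `span_eq_top_iff_forall_isIrreducible` +
  `span_range_units_conj_eq_top_iff`;
* B4 = `hasGlobalMinimalModel_rat_holds` + Mathlib `integralModel` (the sibling k2's D1, verbatim);
* B6 = `conductorNorm_smul_rat` + `LFunction_smul` (the tree's `Summit.ABC.ABC.Theorems.isModular_smul_iff`,
  re-derived here in three lines to keep the imports light).

Net effect (kernel-checked below): closer D `stub_liftThree_of_FLS2015_theorem3` now has EXACTLY ONE
open helper, the prime-independent L-debt B3/D4a shared with `stub_liftFive`; and the heaviest seat,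
LIFT(3) in the tree's own `hlift3` shape (`BCDTTheoremAOfLiftThreeProofs`), closes the stub in two lines.
-/

set_option autoImplicit false
set_option linter.dupNamespace false

noncomputable section

open scoped MatrixGroups NumberField Polynomial
open Polynomial NumberField
open Literature.NumberTheory.EllipticCurves
open Literature.NumberTheory.EllipticCurves.ModularForms
open Literature.NumberTheory.Automorphic
open Literature.NumberTheory.Automorphic.BCDT
open Literature.NumberTheory.GaloisRepresentations
open Literature.RepresentationTheory.Semisimple

universe v

namespace Summit.ABC.ABC.Cruxes.FreyModularity.Sketch.StubIdeas1g4

/-- The registered signature of `stub_liftThree` (verbatim copy; the stub itself is not re-typed). -/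
def SigStubLiftThree : Prop :=
  ∀ (W : WeierstrassCurve ℚ) [W.IsElliptic] (ρ : ModPGaloisRep ℚ (ZMod 3) 2),
    W.IsTorsionGaloisRep 3 ρ → ρ.IsAbsIrreducibleOverSqrt (-3) → ¬ 9 ∣ W.conductorNorm ℤ →
    ρ.IsModular → W.IsModularGaloisRepTate 3

/-! ## §1  Absolute irreducibility depends only on the image (Burnside) — R1 and D1b, PROVED -/

section Image

variable {G : Type*} [Group G] [TopologicalSpace G] {H₁ : Type*} [Group H₁] [TopologicalSpace H₁]
  {H₂ : Type*} [Group H₂] [TopologicalSpace H₂] {A : Type v} [Field A] [TopologicalSpace A] {n : ℕ}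

/-- **R1 (PROVED; generalises the tree's `FramedRep.IsAbsolutelyIrreducible.of_comp`).** If the
pull-back of `ρ` along `φ₁` is absolutely irreducible and `φ₁(H₁) ⊆ φ₂(H₂)`, the pull-back along
`φ₂` is absolutely irreducible: by Burnside (`span_eq_top_iff_forall_isIrreducible`) absolute
irreducibility of `ρ ∘ φ` says the matrices `ρ(φ(h))` span `M_n`, which is monotone in the image.
[folklore] -/
theorem isAbsolutelyIrreducible_comp_of_range_subset (hn : 0 < n) (ρ : FramedRep G A n)
    (φ₁ : H₁ →ₜ* G) (φ₂ : H₂ →ₜ* G) (hle : Set.range φ₁ ⊆ Set.range φ₂)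
    (h : FramedRep.IsAbsolutelyIrreducible (ρ.comp φ₁)) :
    FramedRep.IsAbsolutelyIrreducible (ρ.comp φ₂) := by
  have h1 := (span_eq_top_iff_forall_isIrreducible hn
    ((ρ.comp φ₁ : FramedRep H₁ A n) : H₁ →* GL (Fin n) A)).2 h
  refine (span_eq_top_iff_forall_isIrreducible hn
    ((ρ.comp φ₂ : FramedRep H₂ A n) : H₂ →* GL (Fin n) A)).1 (eq_top_iff.2 ?_)
  rw [← h1]
  refine Submodule.span_mono ?_
  rintro _ ⟨x, rfl⟩
  obtain ⟨y, hy⟩ := hle ⟨x, rfl⟩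
  refine ⟨y, ?_⟩
  change ((ρ (φ₂ y) : GL (Fin n) A) : Matrix (Fin n) (Fin n) A) =
    ((ρ (φ₁ x) : GL (Fin n) A) : Matrix (Fin n) (Fin n) A)
  rw [hy]

/-- **D1b (PROVED; = gen 3's D1b and k2's H3d core).** Absolute irreducibility is invariant under
a change of frame `ρ ↦ P ρ P⁻¹`: Burnside + `span_range_units_conj_eq_top_iff`. [folklore] -/
theorem isAbsolutelyIrreducible_conj [IsTopologicalRing A] (hn : 0 < n) (P : GL (Fin n) A)
    {ρ : FramedRep G A n} (h : ρ.IsAbsolutelyIrreducible) :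
    FramedRep.IsAbsolutelyIrreducible (FramedRep.conj P ρ) := by
  have h1 := (span_eq_top_iff_forall_isIrreducible hn (ρ : G →* GL (Fin n) A)).2 h
  refine (span_eq_top_iff_forall_isIrreducible hn
    ((FramedRep.conj P ρ : FramedRep G A n) : G →* GL (Fin n) A)).1 ?_
  have hfun : (fun g => (((FramedRep.conj P ρ : FramedRep G A n) : G →* GL (Fin n) A) g :
      Matrix (Fin n) (Fin n) A)) = fun g =>
      ((P⁻¹⁻¹ : GL (Fin n) A) : Matrix (Fin n) (Fin n) A) *
        ((ρ g : GL (Fin n) A) : Matrix (Fin n) (Fin n) A) * ((P⁻¹ : GL (Fin n) A) : Matrix _ _ A) := by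
    funext g
    rw [inv_inv]
    rfl
  rw [hfun, span_range_units_conj_eq_top_iff]
  exact h1

end Image

/-! ## §2  `Γ_{ℚ(√-3)} ⊆ Γ_{ℚ(ζ₃)}` inside `Γ_ℚ` — R0, PROVED from two tree lemmas; D1 PROVED -/

/-- **R0 (PROVED).** For any splitting field `L₁` of `X² + 3` and any model `L₂` of `ℚ(ζ₃)`, the
image of `Γ_{L₁} → Γ_ℚ` lies in the image of `Γ_{L₂} → Γ_ℚ`: both are governed by `χ̄₃ = 1`
(`Summit.ABC.ABC.Theorems.modPCyclotomicCharacter_three_eq_one_of_mem_range`, landed for this crux's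
stub R3; `mem_range_absGaloisRestrict_cyclotomic_iff`, FLS Prop. 3.1 (i)).  Replaces gen 3's D1a
(`IsSplittingField ℚ L₂ (X²+3)`), which is no longer needed. [folklore] -/
theorem range_absGaloisRestrict_sqrt_subset_cyclotomic
    (L₁ : Type*) [Field L₁] [Algebra ℚ L₁] [IsSplittingField ℚ L₁ (X ^ 2 - C (-3 : ℚ))]
    (L₂ : Type*) [Field L₂] [Algebra ℚ L₂] [IsCyclotomicExtension {3} ℚ L₂] :
    Set.range (absGaloisRestrict ℚ L₁) ⊆ Set.range (absGaloisRestrict ℚ L₂) := by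
  intro γ hγ
  haveI : Fact (Nat.Prime 3) := ⟨Nat.prime_three⟩
  haveI : NeZero ((3 : ℕ) : ℚ) := ⟨by norm_num⟩
  obtain ⟨τ, hτ⟩ := MonoidHom.mem_range.1 ((mem_range_absGaloisRestrict_cyclotomic_iff 3 L₂ γ).2
    (Summit.ABC.ABC.Theorems.modPCyclotomicCharacter_three_eq_one_of_mem_range L₁ hγ))
  exact ⟨τ, hτ⟩

/-- `restrictField` commutes with a change of frame (definitional). [folklore] -/
theorem restrictField_conj {K : Type*} [Field K] {A : Type*} [Field A] [TopologicalSpace A]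
    [IsTopologicalRing A] {n : ℕ} (L : Type*) [Field L] [Algebra K L] (P : GL (Fin n) A)
    (ρ : FramedGaloisRep K A n) :
    FramedGaloisRep.restrictField L (FramedRep.conj P ρ) =
      FramedRep.conj P (FramedGaloisRep.restrictField L ρ) := rfl

/-- **D1 core (PROVED) over VARIABLE models**: `ρ̄|_{Γ_{L₁}}` absolutely irreducible for a splitting
field `L₁` of `X² + 3` ⇒ `(P ρ̄ P⁻¹)|_{Γ_{L₂}}` absolutely irreducible for every model `L₂` of
`ℚ(ζ₃)` and every frame change `P` (D1b, then R0 + R1). [folklore] -/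
theorem isAbsolutelyIrreducible_restrictField_cyclotomic_of_sqrt
    {L₁ : Type*} [Field L₁] [Algebra ℚ L₁] [IsSplittingField ℚ L₁ (X ^ 2 - C (-3 : ℚ))]
    (L₂ : Type*) [Field L₂] [Algebra ℚ L₂] [IsCyclotomicExtension {3} ℚ L₂]
    (ρ : ModPGaloisRep ℚ (ZMod 3) 2) (P : GL (Fin 2) (ZMod 3))
    (h : FramedRep.IsAbsolutelyIrreducible (FramedGaloisRep.restrictField L₁ ρ)) :
    FramedRep.IsAbsolutelyIrreducible (FramedGaloisRep.restrictField L₂ (FramedRep.conj P ρ)) := by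
  have h₂ : FramedRep.IsAbsolutelyIrreducible
      (FramedGaloisRep.restrictField L₁ (FramedRep.conj P ρ)) := by
    rw [restrictField_conj]
    exact isAbsolutelyIrreducible_conj two_pos P h
  exact isAbsolutelyIrreducible_comp_of_range_subset two_pos (FramedRep.conj P ρ)
    (absGaloisRestrict ℚ L₁) (absGaloisRestrict ℚ L₂)
    (range_absGaloisRestrict_sqrt_subset_cyclotomic L₁ L₂) h₂

/-- **D1 (PROVED, no helper left).** ONE framed model `ρ̄` of `W[3]` with `ρ̄|_{ℚ(√-3)}` absolutely
irreducible (`IsAbsIrreducibleOverSqrt (-3)`, the stub's binder) gives FLS's hypothesis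
`ModPImageAbsIrreducibleOverCyclotomic W 3` (ALL framings, ALL models of `ℚ(ζ₃)`): other framings
are `P ρ̄ P⁻¹` (`IsTorsionGaloisRep.exists_conj_eq`); the binder is read at Mathlib's model
`SplittingField (X²+3)` (as in the tree's `IsAbsIrreducibleOverSqrt.isAbsolutelyIrreducible`). [folklore] -/
theorem modPImageAbsIrreducibleOverCyclotomic_three_of_isAbsIrreducibleOverSqrt
    (W : WeierstrassCurve ℚ) [W.IsElliptic] (ρ : ModPGaloisRep ℚ (ZMod 3) 2)
    (hρ : W.IsTorsionGaloisRep 3 ρ) (hirr : ρ.IsAbsIrreducibleOverSqrt (-3)) :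
    ModPImageAbsIrreducibleOverCyclotomic W 3 := by
  intro ρ' hρ' L _ _ _
  obtain ⟨P, rfl⟩ := hρ.exists_conj_eq hρ'
  exact @isAbsolutelyIrreducible_restrictField_cyclotomic_of_sqrt
    (X ^ 2 - C (-3 : ℚ) : ℚ[X]).SplittingField _ (_) (IsSplittingField.splittingField _) L _ _ _ ρ P
    (@hirr (X ^ 2 - C (-3 : ℚ) : ℚ[X]).SplittingField _ (_) (IsSplittingField.splittingField _))

/-! ## §3  The two ℚ-bridges B4, B6 — PROVED by citation -/

open WeierstrassCurve in
/-- **B4 (PROVED; ≡ the sibling k2's `exists_integralModel`, `STUB_IDEAS_stub_liftFive_2.lean` —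
land ONE copy).** `hasGlobalMinimalModel_rat_holds` + Mathlib `integralModel` /
`baseChange_integralModel_eq` + `IsGloballyMinimal.Δ_ne_zero`. [folklore] -/
theorem exists_integralModel (W : WeierstrassCurve ℚ) [W.IsElliptic] :
    ∃ (E : WeierstrassCurve (𝓞 ℚ)) (C : WeierstrassCurve.VariableChange ℚ)
      (_ : (E.baseChange ℚ).IsElliptic), E.Δ ≠ 0 ∧ C • W = E.baseChange ℚ := by
  obtain ⟨C, hC⟩ := hasGlobalMinimalModel_rat_holds W
  haveI := hC
  refine ⟨(C • W).integralModel (𝓞 ℚ), C, ?_, IsGloballyMinimal.Δ_ne_zero (C • W), ?_⟩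
  · rw [baseChange_integralModel_eq (𝓞 ℚ) (C • W)]; infer_instance
  · rw [baseChange_integralModel_eq (𝓞 ℚ) (C • W)]

/-- `BCDT.IsModular W` read at any level equal to `N_W` (the tree's
`Summit.ABC.ABC.Theorems.isModular_iff_exists_isNewformOf_of_eq`, copied to keep imports light). [folklore] -/
theorem isModular_iff_exists_isNewformOf_of_eq (W : WeierstrassCurve ℚ)
    [NeZero (W.conductorNorm ℤ)] {N : ℕ} [NeZero N] (h : W.conductorNorm ℤ = N) :
    BCDT.IsModular W ↔ ∃ f : CuspForm (CongruenceSubgroup.Gamma0 N) 2, IsNewformOf W f := by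
  subst h
  rfl

/-- **B6 core (PROVED; = `Summit.ABC.ABC.Theorems.isModular_smul_iff`).** Modularity is a property
of the curve, not the model: `N_{C•W} = N_W` (`conductorNorm_smul_rat`) and `aₙ(C•W) = aₙ(W)`
(`LFunction_smul`). [folklore] -/
theorem isModular_smul_iff (W : WeierstrassCurve ℚ) [W.IsElliptic]
    (C : WeierstrassCurve.VariableChange ℚ) [NeZero (W.conductorNorm ℤ)]
    [NeZero ((C • W).conductorNorm ℤ)] : BCDT.IsModular (C • W) ↔ BCDT.IsModular W := by
  rw [isModular_iff_exists_isNewformOf_of_eq (C • W) (W.conductorNorm_smul_rat C)]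
  refine exists_congr fun f ↦ ?_
  simp only [IsNewformOf, WeierstrassCurve.LFunction_smul]

/-- **B6 in gen 3's shape (PROVED).** [folklore] -/
theorem isModular_of_smul_eq (W : WeierstrassCurve ℚ) [W.IsElliptic] [NeZero (W.conductorNorm ℤ)]
    (C : WeierstrassCurve.VariableChange ℚ) (W' : WeierstrassCurve ℚ) [NeZero (W'.conductorNorm ℤ)]
    (hCW : C • W = W') : BCDT.IsModular W' → BCDT.IsModular W := by
  subst hCW
  exact (isModular_smul_iff W C).mp

/-! ## §4  The ONE remaining helper of the FLS road: B3 (= D4a + two leaves already in the line) -/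

/-- **B3 (L — candidate NAMED FACT, prime-independent; verbatim gen 3 / sibling).** Adelic ⇒
classical over `ℚ`: a weight-zero cuspidal `π` of `GL₂(𝔸_ℚ)` matching `E` at all `p ∤ Δ(E)`
(`IsAutomorphicOfWeightZero E`) yields the newform of `BCDT.IsModular (E ⊗ ℚ)` (new vector —
Casselman 1973; Gelbart 1975 Thm 5.19 / Prop 6.21; Eichler–Shimura; Faltings; Carayol).  Gen 3
splits it as D4a + `isModular_of_isNewform0_of_cuspCoeff_eq_off_of_three_facts` (tree). -/
def IsModularOfAutomorphicRat : Prop :=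
  ∀ (E : WeierstrassCurve (𝓞 ℚ)) [(E.baseChange ℚ).IsElliptic]
    [NeZero ((E.baseChange ℚ).conductorNorm ℤ)],
    E.Δ ≠ 0 → IsAutomorphicOfWeightZero E → BCDT.IsModular (E.baseChange ℚ)

/-- **Closer D (GEN 4): kernel-checked with NO sorried helper** — trust base {`FLS2015_theorem3`
(accepted named fact), B3}.  The stub's binders `¬ 9 ∣ N_W`, `ρ.IsModular` are unused (Disproof.lean
§B6). [folklore] -/
theorem stub_liftThree_of_FLS2015_theorem3 (h : FLS2015_theorem3) (hB3 : IsModularOfAutomorphicRat) :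
    SigStubLiftThree := by
  intro W _ ρ hρ hirr _ _
  haveI : NeZero (W.conductorNorm ℤ) := ⟨(WeierstrassCurve.conductorNorm_pos_holds W).ne'⟩
  obtain ⟨E, C, _, hΔ, hCW⟩ := exists_integralModel W
  haveI : NeZero ((E.baseChange ℚ).conductorNorm ℤ) :=
    ⟨(WeierstrassCurve.conductorNorm_pos_holds (E.baseChange ℚ)).ne'⟩
  have himgW : ModPImageAbsIrreducibleOverCyclotomic W 3 :=
    modPImageAbsIrreducibleOverCyclotomic_three_of_isAbsIrreducibleOverSqrt W ρ hρ hirr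
  have himgE : ModPImageAbsIrreducibleOverCyclotomic (E.baseChange ℚ) 3 := by
    intro ρ' hρ' L _ _ _
    have hW : W.IsTorsionGaloisRep 3 ρ' := by
      have h' := MatarNekovar2019.isTorsionGaloisRep_smul (E.baseChange ℚ) C⁻¹ hρ'
      rwa [← hCW, inv_smul_smul] at h'
    exact himgW ρ' hW L
  have hE : IsAutomorphicOfWeightZero E := h ℚ E hΔ 3 (Or.inl rfl) himgE
  exact (isModular_of_smul_eq W C (E.baseChange ℚ) hCW (hB3 E hΔ hE)).isModularGaloisRepTate 3

/-- The same from the JOINT carrier `FLS2015_theorems3_4` (seat of the Langlands-summit route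
`SqrtFiveQuarticCovers`). [folklore] -/
theorem stub_liftThree_of_FLS2015_theorems3_4 (h : FLS2015_theorems3_4)
    (hB3 : IsModularOfAutomorphicRat) : SigStubLiftThree :=
  stub_liftThree_of_FLS2015_theorem3 (FLS2015_theorem3_of_theorems3_4 h) hB3

/-! ## §5  The heaviest seat, recognised IN THE TREE's own shape: LIFT(3) (`hlift3` of
`BCDTTheoremAOfLiftThreeProofs`; Kisin 2009 Cor. 3.5.8 ∪ CDT Thm 7.2.1 / Diamond 1996 Thm 5.4) -/

/-- **LIFT(3)** — verbatim the binder `hlift3` of the tree's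
`CDT_theorem_7_2_1_of_modThree_of_liftThree` / `exists_isNewformOf_iff_liftThree_of_…`: weight-two
modularity lifting at `p = 3` with NO condition at `3`.  One vend of this Prop serves this stub,
`CDT_theorem_7_2_1`, BCDT's wild fact and Theorem A (tree: `exists_isNewformOf_iff_liftThree_…`).
[cite: KisinModuli2009, Cor. 3.5.8] -/
def LiftThree : Prop :=
  ∀ (W : WeierstrassCurve ℚ) [W.IsElliptic] [NeZero (W.conductorNorm ℤ)]
    (ρ : ModPGaloisRep ℚ (ZMod 3) 2), W.IsTorsionGaloisRep 3 ρ →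
    ρ.IsAbsIrreducibleOverSqrt (-3) → ρ.IsModular → BCDT.IsModular W

/-- **Closer E (PROVED, two lines):** LIFT(3) closes the stub (`¬ 9 ∣ N_W` unused; `ρ.IsModular`
USED — the only road on which the stub's residual-modularity binder is load-bearing). [folklore] -/
theorem stub_liftThree_of_liftThree (h : LiftThree) : SigStubLiftThree := by
  intro W _ ρ hρ hirr _ hmod
  haveI : NeZero (W.conductorNorm ℤ) := ⟨(WeierstrassCurve.conductorNorm_pos_holds W).ne'⟩
  exact (h W ρ hρ hirr hmod).isModularGaloisRepTate 3

/-- Calibration: with Langlands–Tunnell in the form `hmod3`, `LiftThree` yields the named fact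
`CDT_theorem_7_2_1` (its `27 ∤ N_E` unused) — this is the tree's
`CDT_theorem_7_2_1_of_modThree_of_liftThree` (module `BCDTTheoremAOfLiftThreeProofs`, whose binder
`hlift3` is literally `LiftThree`; that module is not yet built on the farm 2026-08-31, so the
one-line proof is repeated instead of imported). [cite: ConradDiamondTaylor1999, Thm. 7.2.1] -/
theorem CDT_theorem_7_2_1_of_liftThree
    (hmod3 : ∀ (W : WeierstrassCurve ℚ) [W.IsElliptic] (ρ : ModPGaloisRep ℚ (ZMod 3) 2),
      W.IsTorsionGaloisRep 3 ρ → FramedRep.IsAbsolutelyIrreducible ρ → ρ.IsModular)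
    (h : LiftThree) : CDT_theorem_7_2_1 :=
  fun W _ _ ρ hρ hirr _ ↦ h W ρ hρ hirr (hmod3 W ρ hρ hirr.isAbsolutelyIrreducible)

end Summit.ABC.ABC.Cruxes.FreyModularity.Sketch.StubIdeas1g4

end
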